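import Summits.Ventures.GridStability.Bench.NE39SPPolytopeRate
import HarnessLib

/-!
# GridStability/Bench/NE39SPPolytopeRateCentral — «SP-RATE-POLYTOPE» at 39-bus size, constant lever: a
# CENTRALLY ROOTED BFS tree of the NE39-SP coupling graph has depth `7` (not `11`), so the diameter pair of
# p550229 holds with `d = 14` and ★ #126's line-branch constant `88·ΣD/β` becomes `56·ΣD/β`

Cell `gridfusion` (LADDER-GRIDFUSION), seat gridfusion-lyap-1 (g8). ★ #126 (`Bench/NE39SPPolytopeRate.lean`,
p563451) and g7's window census (p552371) use the diameter pair `Σ Dᵢφᵢ² ≤ (4d·ΣD/β)·Q + (2Σ_gen M/ΣD)·K`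
with `d = 22 = 2·11`, the depth of model-2's BFS parent array rooted at generator G1 (idx `39`, a leaf of
the graph). Rooting the BFS tree at BUS 36 (idx `35`, the graph centre of column LF) gives depth `7`, hence
walks of length `≤ 14` between all 49 nodes and `d = 14`: the constant `88` becomes `56` in both rate rows,
by 147 `decide` checks on a new parent array and NO new analysis. CONTENTS: `parentC`, `depthC`,
`treeEdgeC` (the centrally rooted BFS tree as data), `diam_le14`, **`polytope_energy_decay56`** (★ #126's
sentence with `88 ↦ 56`: for every `D > 0`, … `ρ(1 + h·(56ΣD/β)/(299/1000)) ≤ h`, …). Illustrative uniform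
`Dᵢ = d = 1/20` pu (VALIDATED, exact from the four inequalities): line branch `ρ ≤ 0.00749 s⁻¹` (vs
`0.00669` with `88`), kinetic branch `0.00928`. THREE COLUMNS as in ★ #126; nothing here says the New
England system is stable or well damped. No named fact; standard axioms; generator: this seat's BFS over
model-2's edge list (`tools/ne39sp_spec.py`). [cite: Khalil2002, Theorem 4.10]; [cite: VuTuritsyn2016, §IV]
-/

noncomputable section

open Set Filter Topology Real Finset
open Summit.Ventures.GridStability.Models
open Summit.Ventures.GridStability.Models.StructurePreserving
open Summit.Ventures.GridStability.Models.NE39SP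
open Summit.Ventures.GridStability.Lyapunov.StructurePreserving (EdgeRateCert
  energy_le_mul_exp_neg_of_isSolution_vt sum_D_sq_le_of_diam exists_walk_length_le_of_parent)
open Literature.MathematicalPhysics.PowerSystems.ClassicalModel.LosslessSystem (vtGap)

namespace Summit.Ventures.GridStability.Bench.NE39SP

/-! ### The centrally rooted BFS tree (root = bus 36, idx 35) -/

/-- BFS parent array of the column-LF coupling graph rooted at bus 36 (idx `35`; `parentC 35 = 35`). -/
def parentC : Fin 49 → Fin 49 :=
  ![15, 10, 19, 29, 38, 21, 22, 24, 28, 11, 11, 12, 37, 33, 13, 14, 15, 14, 17, 32, 35, 20, 23, 35,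
    25, 26, 36, 25, 25, 38, 19, 32, 33, 34, 35, 35, 35, 36, 35, 0, 1, 2, 3, 4, 5, 6, 7, 8, 9]

/-- BFS depths from bus 36: maximum `7` (at G1, G2), `Σ depth = 185`. -/
def depthC : Fin 49 → ℕ :=
  ![6, 6, 5, 3, 2, 3, 3, 5, 5, 5, 5, 4, 3, 3, 4, 5, 6, 5, 6, 4, 1, 2, 2, 1, 4, 3, 2, 4, 4, 2, 5, 4, 3, 2,
    1, 0, 1, 2, 1, 7, 7, 6, 4, 3, 4, 4, 6, 6, 6]

/-- For each node, the index of the listed edge joining it to its central-tree parent (root: arbitrary). -/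
def treeEdgeC : Fin 49 → Fin 56 :=
  ![0, 2, 5, 7, 9, 11, 13, 15, 17, 19, 21, 22, 25, 27, 26, 28, 30, 29, 33, 35, 37, 36, 39, 40, 41, 42,
    45, 43, 44, 47, 34, 49, 50, 51, 52, 0, 53, 55, 54, 1, 4, 6, 8, 10, 12, 14, 16, 18, 20]

/-- **Every two nodes of the NE39-SP coupling graph are joined by a walk of length `≤ 14`**: the parent
array `parentC` is a spanning structure of depth `7` (49 `decide` checks for the tree edges, 49 for the
depth decrease, 49 for the depth bound; g7's `exists_walk_length_le_of_parent`). CERTIFIED. [folklore] -/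
theorem diam_le14 (D : Fin 49 → ℝ) :
    ∀ i j : Fin 49, ∃ w : (params D).couplingGraph.Walk i j, w.length ≤ 2 * 7 := by
  have hne : ∀ v : Fin 49, v ≠ 35 → parentC v ≠ v :=
    fun v hv => (by decide : ∀ v : Fin 49, v ≠ 35 → parentC v ≠ v) v hv
  have hb' : ∀ v : Fin 49, v ≠ 35 → (params D).b (parentC v) v ≠ 0 := by
    intro v hv
    rw [params_b]
    refine symmetrize_edgeWeight_ne_zero_of_edge wt_nonneg (treeEdgeC v) (wt_pos _) ?_
    exact (by decide : ∀ v : Fin 49, v ≠ 35 →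
      (srcV (treeEdgeC v) = parentC v ∧ tgtV (treeEdgeC v) = v)
        ∨ (srcV (treeEdgeC v) = v ∧ tgtV (treeEdgeC v) = parentC v)) v hv
  have hadj : ∀ v : Fin 49, v ≠ 35 → (params D).couplingGraph.Adj v (parentC v) := fun v hv =>
    (((params D).couplingGraph_adj_of_symm b_symm (parentC v) v).2 ⟨hne v hv, hb' v hv⟩).symm
  have hdepth : ∀ v : Fin 49, v ≠ 35 → depthC (parentC v) < depthC v :=
    fun v hv => (by decide : ∀ v : Fin 49, v ≠ 35 → depthC (parentC v) < depthC v) v hv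
  have he : ∀ v : Fin 49, depthC v ≤ 7 := by decide
  exact exists_walk_length_le_of_parent 35 parentC depthC hadj hdepth he

/-! ### ★ #126's sentence with the constant `56` -/

/-- **NE39-SP (column LF): exponential decay of the energy on the polytope region of level `15` with the
line-branch constant `56·ΣD/β`** — ★ #126's `polytope_energy_decay` (p563451) VERBATIM except `88 ↦ 56`
(diameter pair with `d = 14` from `diam_le14`). For every `D > 0`, `h > 0` with `2hMᵢ ≤ Dᵢ` on the ten
machines, `ρ ≥ 0` and `C` with `ρ(2 + h·2(7827/1885)/ΣD) ≤ 2h`, `ρ(1 + h·(56ΣD/β)/(299/1000)) ≤ h`,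
`2 + h·2(7827/1885)/ΣD ≤ C`, `1 + h·(56ΣD/β)/(299/1000) ≤ C`: every solution from
`{V ≤ 15} ∩ 𝒫 ∩ leaf` obeys `V(δ₀; δ(t), δ̇(t)) ≤ 3C·V(δ₀; δ(0), δ̇(0))·exp(−ρt)` for all `t ≥ 0`.
CERTIFIED for MODEL M′ only; nothing here says the New England system is stable or well damped.
[cite: Khalil2002, Theorem 4.10]; [cite: VuTuritsyn2016, §IV]; [cite: Padiyar2013, App. D, §3.2] -/
theorem polytope_energy_decay56 {D : Fin 49 → ℝ} (hD : ∀ i, 0 < D i) {h : ℝ} (hh : 0 < h)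
    (hhM : ∀ i ∈ genS, 2 * h * (MQ i : ℝ) ≤ D i) {ρ : ℝ} (hρ0 : 0 ≤ ρ)
    (hρK : ρ * (2 + h * (2 * (7827 / 1885 : ℝ) / (∑ i, D i))) ≤ 2 * h)
    (hρW : ρ * (1 + h * (56 * (∑ i, D i) / (betaLF : ℝ)) / (299 / 1000)) ≤ h)
    {C : ℝ} (hCK : 2 + h * (2 * (7827 / 1885 : ℝ) / (∑ i, D i)) ≤ C)
    (hCW : 1 + h * (56 * (∑ i, D i) / (betaLF : ℝ)) / (299 / 1000) ≤ C)
    {δ : ℝ → Fin 49 → ℝ} (hδ : (params D).IsSolution δ)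
    (hpol : ∀ i j, (params D).b i j ≠ 0 → |(δ 0 i - δ 0 j) + (NE39SP.δ₀ i - NE39SP.δ₀ j)| < π)
    (hL : (params D).momentum (δ 0) (fun i => deriv (fun u => δ u i) 0)
      = (params D).momentum NE39SP.δ₀ 0)
    (hV : (params D).energy NE39SP.δ₀ (δ 0) (fun i => deriv (fun u => δ u i) 0) ≤ 15)
    {t : ℝ} (ht : 0 ≤ t) :
    (params D).energy NE39SP.δ₀ (δ t) (fun i => deriv (fun u => δ u i) t)
      ≤ 3 * C * (params D).energy NE39SP.δ₀ (δ 0) (fun i => deriv (fun u => δ u i) 0)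
        * Real.exp (-ρ * t) := by
  obtain ⟨ℓ, u, hc⟩ := exists_cert D
  have hs : (params D).shifted.IsSolution δ := by
    rw [(params D).shifted_eq_self_of_P0_eq_pe NE39SP.b_symm (NE39SP.params_P0 D)]
    exact hδ
  have hb : ∀ i j, 0 ≤ (params D).b i j := fun i j => by rw [params_b]; exact b_nonneg i j
  have hhM' : ∀ i ∈ (params D).gen, 2 * h * (params D).M i ≤ (params D).D i := hhM
  have hSD : 0 < ∑ i, D i := by
    have := Finset.sum_pos (fun i _ => hD i) (Finset.univ_nonempty (α := Fin 49))
    simpa using this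
  have hA : (0 : ℝ) ≤ 56 * (∑ i, D i) / (betaLF : ℝ) := by
    have := beta_pos
    positivity
  have hPoinc : ∀ x : (Fin 49 → ℝ) × (Fin 49 → ℝ),
      x ∈ Lyapunov.StructurePreserving.constraintSet (params D) NE39SP.δ₀ →
      ∑ i, (params D).D i * (x.1 i - NE39SP.δ₀ i) ^ 2
        ≤ 56 * (∑ i, D i) / (betaLF : ℝ)
            * ((1 / 2) * ∑ i, ∑ j, (params D).b i j
              * (((x.1 i - x.1 j) - (NE39SP.δ₀ i - NE39SP.δ₀ j)) ^ 2 / 2))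
          + 2 * (7827 / 1885 : ℝ) / (∑ i, D i) * (params D).kinetic x.2 := by
    intro x hx
    have h1 := sum_D_sq_le_of_diam (wellFormed hD) (by decide) hb beta_pos (edge_lower D) (diam_le14 D)
      hx
    rw [sum_gen_M D] at h1
    have e2 : (∑ i, (params D).D i) = ∑ i, D i := rfl
    rw [e2] at h1
    have e1 : (4 : ℝ) * ((2 * 7 : ℕ) : ℝ) * (∑ i, D i) / (betaLF : ℝ)
        = 56 * (∑ i, D i) / (betaLF : ℝ) := by
      push_cast
      ring
    rw [e1] at h1
    exact h1
  have hρW' : ρ * (1 + h * (56 * (∑ i, D i) / (betaLF : ℝ)) / (299 / 1000)) ≤ h * 1 := by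
    rw [mul_one]; exact hρW
  have hcgap : ∀ i j, (params D).b i j ≠ 0 →
      (15 : ℝ) < (params D).b i j * vtGap (NE39SP.δ₀ i - NE39SP.δ₀ j) :=
    fun i j hij => lt_trans (by norm_num) (level_lt_edgeGap D i j hij)
  exact energy_le_mul_exp_neg_of_isSolution_vt (wellFormed hD) (by decide) (preconnected D) hb
    (window_strict D) (isSyncEquilibrium D) hcgap hc (by norm_num) hh hhM' hA hPoinc hρ0 hρK hρW'
    hCK hCW hs hpol hL hV ht

end Summit.Ventures.GridStability.Bench.NE39SP

end
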